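import Summits.CriticalPhenomena.Ising3DConformalLimit.Theorems.MoebiusLimitExists.Negative.InversionContent
import HarnessLib

/-!
# GKS II in the scaling limit for the two cross pairings (stub `stub_gksCrossPairings`, item stmt-CriticalPhenomena-15523)

For every pointwise scaling limit `S` of the critical `ℤ³` Ising correlators `criticalCorr 3` and every
non-coincident quadruple `x`,

* `S₂(x₀,x₂) S₂(x₁,x₃) ≤ S₄(x)` (pairing `(02|13)`),
* `S₂(x₀,x₃) S₂(x₁,x₂) ≤ S₄(x)` (pairing `(03|12)`).

The pairing `(01|23)` is the tree theorem `MoebiusLimitExistsNegative.limit_four_ge_two_mul_two`; the proof here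
is the same: GKS II with multiplicities on the lattice (`plusCorr_mul_le` on the spin products `A ∆ B` with
`A = {y₀,y₂}`, `B = {y₁,y₃}`, resp. `A = {y₀,y₃}`, `B = {y₁,y₂}`), then `le_of_tendsto_of_tendsto` along the
pointwise limit (the factor `ρ(δ)⁴ ≥ 0` is harmless).
-/

noncomputable section

namespace Summit.CriticalPhenomena.Ising3DConformalLimit.Cruxes.IsingLimitHeritage.Birth

open Literature.Probability.LatticeModels
open Filter Set
open scoped Topology

/-! ### GKS II on the lattice for the cross pairings -/

/-- GKS II at `β_c` with multiplicities, pairing `(02|13)`: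
`⟨σ_{y₀}σ_{y₂}⟩⟨σ_{y₁}σ_{y₃}⟩ ≤ ⟨σ_{y₀}σ_{y₁}σ_{y₂}σ_{y₃}⟩` (tree `plusCorr_mul_le`).
[cite: FriedliVelenik2017, Thm. 3.20, eq. (3.22), p. 109] -/
theorem criticalCorr_four_ge_cross02 (y : Fin 4 → Site 3) :
    criticalCorr 3 2 ![y 0, y 2] * criticalCorr 3 2 ![y 1, y 3] ≤ criticalCorr 3 4 y := by
  classical
  obtain ⟨A, hA⟩ := exists_spinMonomial_eq_spinProduct ![y 0, y 2]
  obtain ⟨B, hB⟩ := exists_spinMonomial_eq_spinProduct ![y 1, y 3]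
  have hy : spinMonomial y = spinProduct (symmDiff A B) := by
    funext s
    have h1 : spinMonomial y s = spinMonomial ![y 0, y 2] s * spinMonomial ![y 1, y 3] s := by
      simp only [spinMonomial, Fin.prod_univ_four, Fin.prod_univ_two, Matrix.cons_val_zero,
        Matrix.cons_val_one]
      ring
    rw [h1, hA, hB, spinProduct_mul_spinProduct]
  show plusExpect 3 (criticalBeta 3) 0 (spinMonomial ![y 0, y 2]) *
      plusExpect 3 (criticalBeta 3) 0 (spinMonomial ![y 1, y 3]) ≤
    plusExpect 3 (criticalBeta 3) 0 (spinMonomial y)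
  rw [hA, hB, hy]
  exact plusCorr_mul_le (criticalBeta_nonneg 3) le_rfl A B

/-- GKS II at `β_c` with multiplicities, pairing `(03|12)`:
`⟨σ_{y₀}σ_{y₃}⟩⟨σ_{y₁}σ_{y₂}⟩ ≤ ⟨σ_{y₀}σ_{y₁}σ_{y₂}σ_{y₃}⟩` (tree `plusCorr_mul_le`).
[cite: FriedliVelenik2017, Thm. 3.20, eq. (3.22), p. 109] -/
theorem criticalCorr_four_ge_cross03 (y : Fin 4 → Site 3) :
    criticalCorr 3 2 ![y 0, y 3] * criticalCorr 3 2 ![y 1, y 2] ≤ criticalCorr 3 4 y := by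
  classical
  obtain ⟨A, hA⟩ := exists_spinMonomial_eq_spinProduct ![y 0, y 3]
  obtain ⟨B, hB⟩ := exists_spinMonomial_eq_spinProduct ![y 1, y 2]
  have hy : spinMonomial y = spinProduct (symmDiff A B) := by
    funext s
    have h1 : spinMonomial y s = spinMonomial ![y 0, y 3] s * spinMonomial ![y 1, y 2] s := by
      simp only [spinMonomial, Fin.prod_univ_four, Fin.prod_univ_two, Matrix.cons_val_zero,
        Matrix.cons_val_one]
      ring
    rw [h1, hA, hB, spinProduct_mul_spinProduct]
  show plusExpect 3 (criticalBeta 3) 0 (spinMonomial ![y 0, y 3]) *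
      plusExpect 3 (criticalBeta 3) 0 (spinMonomial ![y 1, y 2]) ≤
    plusExpect 3 (criticalBeta 3) 0 (spinMonomial y)
  rw [hA, hB, hy]
  exact plusCorr_mul_le (criticalBeta_nonneg 3) le_rfl A B

/-! ### Passage to the pointwise limit -/

/-- **GKS II passes to any pointwise limit, pairing `(02|13)`**: `S₂(x₀,x₂) S₂(x₁,x₃) ≤ S₄(x)` on
non-coincident `x`. [cite: FriedliVelenik2017, Thm. 3.20, eq. (3.22), p. 109] -/
theorem limit_four_ge_cross02 {ρ : ℝ → ℝ} {S : CorrFamily 3}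
    (hlim : HasPointwiseScalingLimit (criticalCorr 3) ρ S)
    {x : Fin 4 → EuclideanSpace ℝ (Fin 3)} (hx : x ∈ NonCoincident 3 4) :
    S 2 ![x 0, x 2] * S 2 ![x 1, x 3] ≤ S 4 x := by
  have hinj : Function.Injective x := hx
  have h02 : (![x 0, x 2] : Fin 2 → EuclideanSpace ℝ (Fin 3)) ∈ NonCoincident 3 2 :=
    pair_mem_nonCoincident (hinj.ne (by decide))
  have h13 : (![x 1, x 3] : Fin 2 → EuclideanSpace ℝ (Fin 3)) ∈ NonCoincident 3 2 :=
    pair_mem_nonCoincident (hinj.ne (by decide))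
  refine le_of_tendsto_of_tendsto (((hlim 2).tendsto_at h02).mul ((hlim 2).tendsto_at h13))
    ((hlim 4).tendsto_at hx) (Filter.Eventually.of_forall fun δ => ?_)
  simp only [rescaledCorrelator_apply]
  have key := criticalCorr_four_ge_cross02 (fun i => latticeApprox δ (x i))
  have e02 : (fun i => latticeApprox δ ((![x 0, x 2] : Fin 2 → EuclideanSpace ℝ (Fin 3)) i)) =
      ![latticeApprox δ (x 0), latticeApprox δ (x 2)] := by
    funext i; fin_cases i <;> rfl
  have e13 : (fun i => latticeApprox δ ((![x 1, x 3] : Fin 2 → EuclideanSpace ℝ (Fin 3)) i)) =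
      ![latticeApprox δ (x 1), latticeApprox δ (x 3)] := by
    funext i; fin_cases i <;> rfl
  rw [e02, e13]
  have h4 : 0 ≤ ρ δ ^ 4 := by positivity
  calc ρ δ ^ 2 * criticalCorr 3 2 ![latticeApprox δ (x 0), latticeApprox δ (x 2)] *
        (ρ δ ^ 2 * criticalCorr 3 2 ![latticeApprox δ (x 1), latticeApprox δ (x 3)])
      = ρ δ ^ 4 * (criticalCorr 3 2 ![latticeApprox δ (x 0), latticeApprox δ (x 2)] *
          criticalCorr 3 2 ![latticeApprox δ (x 1), latticeApprox δ (x 3)]) := by ring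
    _ ≤ ρ δ ^ 4 * criticalCorr 3 4 (fun i => latticeApprox δ (x i)) :=
        mul_le_mul_of_nonneg_left key h4

/-- **GKS II passes to any pointwise limit, pairing `(03|12)`**: `S₂(x₀,x₃) S₂(x₁,x₂) ≤ S₄(x)` on
non-coincident `x`. [cite: FriedliVelenik2017, Thm. 3.20, eq. (3.22), p. 109] -/
theorem limit_four_ge_cross03 {ρ : ℝ → ℝ} {S : CorrFamily 3}
    (hlim : HasPointwiseScalingLimit (criticalCorr 3) ρ S)
    {x : Fin 4 → EuclideanSpace ℝ (Fin 3)} (hx : x ∈ NonCoincident 3 4) :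
    S 2 ![x 0, x 3] * S 2 ![x 1, x 2] ≤ S 4 x := by
  have hinj : Function.Injective x := hx
  have h03 : (![x 0, x 3] : Fin 2 → EuclideanSpace ℝ (Fin 3)) ∈ NonCoincident 3 2 :=
    pair_mem_nonCoincident (hinj.ne (by decide))
  have h12 : (![x 1, x 2] : Fin 2 → EuclideanSpace ℝ (Fin 3)) ∈ NonCoincident 3 2 :=
    pair_mem_nonCoincident (hinj.ne (by decide))
  refine le_of_tendsto_of_tendsto (((hlim 2).tendsto_at h03).mul ((hlim 2).tendsto_at h12))
    ((hlim 4).tendsto_at hx) (Filter.Eventually.of_forall fun δ => ?_)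
  simp only [rescaledCorrelator_apply]
  have key := criticalCorr_four_ge_cross03 (fun i => latticeApprox δ (x i))
  have e03 : (fun i => latticeApprox δ ((![x 0, x 3] : Fin 2 → EuclideanSpace ℝ (Fin 3)) i)) =
      ![latticeApprox δ (x 0), latticeApprox δ (x 3)] := by
    funext i; fin_cases i <;> rfl
  have e12 : (fun i => latticeApprox δ ((![x 1, x 2] : Fin 2 → EuclideanSpace ℝ (Fin 3)) i)) =
      ![latticeApprox δ (x 1), latticeApprox δ (x 2)] := by
    funext i; fin_cases i <;> rfl
  rw [e03, e12]
  have h4 : 0 ≤ ρ δ ^ 4 := by positivity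
  calc ρ δ ^ 2 * criticalCorr 3 2 ![latticeApprox δ (x 0), latticeApprox δ (x 3)] *
        (ρ δ ^ 2 * criticalCorr 3 2 ![latticeApprox δ (x 1), latticeApprox δ (x 2)])
      = ρ δ ^ 4 * (criticalCorr 3 2 ![latticeApprox δ (x 0), latticeApprox δ (x 3)] *
          criticalCorr 3 2 ![latticeApprox δ (x 1), latticeApprox δ (x 2)]) := by ring
    _ ≤ ρ δ ^ 4 * criticalCorr 3 4 (fun i => latticeApprox δ (x i)) :=
        mul_le_mul_of_nonneg_left key h4

/-! ### The registered stub -/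

/-- **stub_gksCrossPairings** (GKS II in the limit, cross pairings). For every pointwise scaling limit `S` of the
critical correlators and every non-coincident quadruple, `S₂(x₀,x₂)S₂(x₁,x₃) ≤ S₄(x)` and
`S₂(x₀,x₃)S₂(x₁,x₂) ≤ S₄(x)`. [cite: FriedliVelenik2017, Thm. 3.20, eq. (3.22), p. 109] -/
theorem stub_gksCrossPairings :
    ∀ (ρ : ℝ → ℝ) (S : CorrFamily 3), HasPointwiseScalingLimit (criticalCorr 3) ρ S →
      ∀ x ∈ NonCoincident 3 4,
        S 2 ![x 0, x 2] * S 2 ![x 1, x 3] ≤ S 4 x ∧ S 2 ![x 0, x 3] * S 2 ![x 1, x 2] ≤ S 4 x :=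
  fun _ρ _S hlim _x hx => ⟨limit_four_ge_cross02 hlim hx, limit_four_ge_cross03 hlim hx⟩

end Summit.CriticalPhenomena.Ising3DConformalLimit.Cruxes.IsingLimitHeritage.Birth

end
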